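import Summits.KontsevichZagierPeriods.KontsevichZagierPeriods.Theses.DimensionBudget
import Summits.KontsevichZagierPeriods.KontsevichZagierPeriods.Theorems.AbelContractionRealHyperellipticSectorPortDimOneAssembly

/-!
# `BakerSectorDimOne` (stmt-KontsevichZagierPeriods-3750, route DimensionBudget) — closing file

The rational (= Baker) sector of dimension `≤ 1` closes INSIDE dimension `≤ 1`: two representations
of KZ's literal (rational) shape of dimensions `n, m ≤ 1` with equal values are connected by moves
among representations of dimension `≤ 1`, i.e. `[r] − [r'] ∈ KZ.relationsLE 1` (the item inlines
`KZ.relationsLE 1` as `AddSubgroup.closure ((domainAddRel ∪ integrandAddRel ∪ changeOfVariablesRel ∪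
newtonLeibnizRel) ∩ closure {dim ≤ 1 generators})`, `KZ.relationsLE_def`).

This is `Port.Dlog.kzConjectureLE_of_dim_le_one`
(`Theorems/AbelContractionRealHyperellipticSectorPortDimOneAssembly.lean`): the dimension-certified
port, inside the budget `KZ.relationsLE 1`, of the tree's proof of Kontsevich–Zagier's Conjecture 1
in dimension `≤ 1` (`PiBox.Dlog.kzConjecture_of_dim_le_one`; compactification by involutive charts,
algebraic break points, partial fractions over `ℚ̄ ∩ ℝ`, Newton–Leibniz `1 → 0` with algebraic
primitives, Baker's theorem `baker_holds`, realisation of multiplicative relations by scalings /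
power maps / Möbius rotations — every move among representations of dimension `1` or `0`),
produced by the lead seat of crux stmt-KontsevichZagierPeriods-12475 (`RealHyperellipticSector`,
route AbelContraction) as the genus-`0` half of that crux. A prover holding item 3750 lands this
file `--workitem stmt-KontsevichZagierPeriods-3750` and releases
`--by Summit.KontsevichZagierPeriods.DimensionBudget.BakerSectorDimOne.bakerSectorDimOne_proof`.

References: M. Kontsevich, D. Zagier, *Periods* (2001), §1.2 Conjecture 1 [KontsevichZagier2001];
A. Baker, *Transcendental Number Theory* (1975), Thm. 2.1 [Baker1975]. No definitions are introduced.
-/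

namespace Summit.KontsevichZagierPeriods.DimensionBudget.BakerSectorDimOne

/-- **Item `BakerSectorDimOne` (stmt-KontsevichZagierPeriods-3750)**: Kontsevich–Zagier's
Conjecture 1 for representations of KZ's rational shape of dimensions `≤ 1`, INSIDE the dimension
budget `1` — equal values imply `[r] − [r'] ∈ KZ.relationsLE 1`. [cite: KontsevichZagier2001, §1.2 Conjecture 1]
[cite: Baker1975, Thm 2.1] -/
theorem bakerSectorDimOne_proof :
    Summit.KontsevichZagierPeriods.KontsevichZagierPeriods.Theses.DimensionBudget.BakerSectorDimOne := by
  intro n m hn hm r r' hr hr' hv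
  exact Summit.KontsevichZagierPeriods.AbelContraction.RealHyperellipticSector.Port.Dlog.kzConjectureLE_of_dim_le_one
    hn hm r r' hr hr' hv

end Summit.KontsevichZagierPeriods.DimensionBudget.BakerSectorDimOne
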